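import Literature.NumberTheory.Automorphic.UnitaryGroupSingularTermValueUniform
import HarnessLib

/-!
# The singular term of `U(J₃)` as `(C·𝔄₀)·log T + C·𝔅₀`, spelled, with ONE constant for all classes
(Rogawski, *Automorphic Representations of Unitary Groups in Three Variables* (1990), §7.2 Prop. 7.2.2, pp. 94–95.)

Topic `NumberTheory/Automorphic`; namespace `Literature.NumberTheory.Automorphic.UnitaryGroup`. THEOREMS ONLY over
accepted tree modules: no definition, no named fact, no instance, no notation, no `sorry`. Brick (U2/U3) of row (L5-iii-c)
of the T1-qs LAW 5 road (`Cruxes/H413/Lines/F0_T1InnerFormTraceIdentity.lean`): the uniform edition of ★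
`exists_integral_weight_smul_singularBracket_eq` (`UnitaryGroupSingularTermValue`) — the Haar-normalisation constant `C` is
produced BEFORE the class data `(a, b, γ₀)`, the test function `f`, the covering weights `β`, `w_T`, the idele class
domain and `T`: the (F1) constant is pinned by its clause (L0) (`∫_G Ψ = C₁ ∫_B ∫_K Ψ(bk)`, tested on a positive compact),
the (G-c) constant does not see the class, and the (C-P) push constant comes first by ★
`exists_pushConst_forall_singularTorusStage_eq_linear` (ED. 2 of `UnitaryGroupSingularTorusPush`).

* `exists_const_forall_integral_weight_smul_singularBracket_eq` — `∃ C > 0, ∀ class f β w_T 𝓕_F T, ∫_G β • b_T[f] dν_G = C · V₀ · BIG_T(f♭)`.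
* `exists_const_forall_integral_weight_smul_singularBracket_eq_mul_log_add` — the same as
  `(C · 𝔄₀(f♭)) · log T + C · 𝔅₀(f♭)` with BOTH `𝔄₀ = V₀ · ½ · V_F · μ_A(D_F)⁻¹ · 𝔉f♭(0)` and `𝔅₀` SPELLED (the
  (σ-ii) finset closer's `a k`, `b k` as functions of the key times one global scalar).

## References
* J. D. Rogawski, *Automorphic Representations of Unitary Groups in Three Variables*, Ann. of Math. Stud. 123 (1990),
  §7.2 Prop. 7.2.2 [Rogawski1990].
* J. Arthur, *The trace formula in invariant form*, Ann. of Math. 114 (1981), §2 [Arthur1981TraceFormulaInvariantForm].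
-/

set_option autoImplicit false

noncomputable section

open MeasureTheory MeasureTheory.Measure NumberField IsDedekindDomain Set Literature.MeasureTheory.Group
open scoped ENNReal NNReal MatrixGroups
open Literature.NumberTheory.Automorphic.Meyer

namespace Literature.NumberTheory.Automorphic

namespace UnitaryGroup

variable {F E : Type} [Field F] [NumberField F] [Field E] [NumberField E] [Algebra F E]
  {c : E ≃ₐ[F] E}

variable [LocallyCompactSpace (AdeleRing (𝓞 E) E)] [LocallyCompactSpace (AdeleRing (𝓞 F) F)]
  [MeasurableSpace (AdeleRing (𝓞 E) E)] [BorelSpace (AdeleRing (𝓞 E) E)]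
  [MeasurableSpace (AdeleRing (𝓞 F) F)] [BorelSpace (AdeleRing (𝓞 F) F)]
  [MeasurableSpace (quasiSplit F E c 3).Adelic] [BorelSpace (quasiSplit F E c 3).Adelic]
  [MeasurableSpace (GaloisRepresentations.ideleGroup F)] [BorelSpace (GaloisRepresentations.ideleGroup F)]
  [Algebra.IsQuadraticExtension F E]

/-- **`∫_G β • b_T[f] dν_G = (C·𝔄₀(f♭))·log T + C·𝔅₀(f♭)` WITH `𝔄₀`, `𝔅₀` SPELLED AND ONE `C` FOR ALL CLASSES** — the (σ-ii) finset
closer's currency: `𝔄₀ = V₀·½·V_F·μ_A(D_F)⁻¹·𝔉f♭(0)`, `𝔅₀ = V₀·(½(−V_F log H(1)·μ_A(D_F)⁻¹𝔉f♭(0) + A + μ_A(D_F)⁻¹Â − V_F f♭(0)) +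
½(A_χ + μ_A(D_F)⁻¹Â_χ))` (`log(T/H₁) = log T − log H₁`). [cite: Rogawski1990, §7.2 Prop. 7.2.2 (pp. 94–95)] -/
theorem exists_const_forall_integral_weight_smul_singularBracket_eq_mul_log_add (hc : c * c = 1) (hc1 : c ≠ 1)
    {δ : E} (hcδ : c δ = -δ) (hδ : δ ≠ 0) (θ₀ : 𝓞 F) (hθ : θ₀ ≠ 0) (hd : δ * δ = algebraMap F E (θ₀ : F))
    (hsq : ¬ IsSquare ((θ₀ : 𝓞 F) : F))
    (hBK : ∀ g : (quasiSplit F E c 3).Adelic, ∃ b ∈ borelAdelic F E c 3, ∃ k : (quasiSplit F E c 3).Adelic,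
      adelicVal F E c 3 ((StdForm.antidiagonal 3).over E) k ∈ standardMaximalCompactGL 3 E ∧ g = b * k)
    (νG : Measure (quasiSplit F E c 3).Adelic) [νG.IsHaarMeasure]
    (μB : Measure (borelAdelic F E c 3)) [μB.IsHaarMeasure]
    (μT : Measure (torusInBorel F E c 3)) [μT.IsHaarMeasure]
    (μK : Measure ↥((standardMaximalCompactGL 3 E).comap (adelicVal F E c 3 ((StdForm.antidiagonal 3).over E)) : Subgroup (quasiSplit F E c 3).Adelic)) [μK.IsHaarMeasure]
    (μX : Measure (AdeleRing (𝓞 E) E)) [μX.IsAddHaarMeasure] [μX.Regular]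
    (μA : Measure (AdeleRing (𝓞 F) F)) [μA.IsAddHaarMeasure] [μA.Regular]
    (νF : Measure (GaloisRepresentations.ideleGroup F)) [νF.IsHaarMeasure] :
    ∃ C : ℝ, 0 < C ∧ ∀ {a b : Eˣ} (hab : (a : E) ≠ (b : E)) {g₀ : (quasiSplit F E c 3).Rational} {γ₀ : (quasiSplit F E c 3).arithmeticSubgroup}
      (hg₀ : ((g₀.val : GL (Fin 3) E) : Matrix (Fin 3) (Fin 3) E) = !![(a : E), 0, 0; 0, b, 0; 0, 0, a])
      (hγ₀ : (γ₀ : (quasiSplit F E c 3).Adelic) = (quasiSplit F E c 3).toAdelic g₀)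
      {f : (quasiSplit F E c 3).Adelic → ℂ} (hf : IsQuasiSplitTest F E c 3 f)
      {β : (quasiSplit F E c 3).Adelic → ℝ≥0∞}
      (hβ : IsCoveringWeight ((arithmeticBorel F E c 3 ⊓
        Subgroup.centralizer ({γ₀} : Set (quasiSplit F E c 3).arithmeticSubgroup)).map (quasiSplit F E c 3).arithmeticSubgroup.subtype) β)
      {wT : torusInBorel F E c 3 → ℝ≥0∞}
      (hwT : IsCoveringWeight ((rationalBorel F E c 3).subgroupOf (torusInBorel F E c 3)) wT)
      {𝓕F : Set (GaloisRepresentations.ideleGroup F)} (h𝓕 : IsIdeleClassDomain F 𝓕F)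
      (T : ℝ≥0), 0 < (T : ℝ) →
      ∫ g, (β g).toReal • ((∑' n : {n : ↥((adelicUnipotent F E c 3).subgroupOf (quasiSplit F E c 3).arithmeticSubgroup ⊓
            Subgroup.centralizer ({γ₀} : Set (quasiSplit F E c 3).arithmeticSubgroup)) // n ≠ 1},
          f ((g)⁻¹ * (((n.1 : (quasiSplit F E c 3).arithmeticSubgroup) * γ₀ : (quasiSplit F E c 3).arithmeticSubgroup) : (quasiSplit F E c 3).Adelic) * (g))) -
        Set.indicator {z : (quasiSplit F E c 3).Adelic | T < borelHeight z}
          (fun z => ((μA.map (traceZeroLine F E c hcδ hδ)) (traceZeroFundamentalDomain F E c)).toReal⁻¹ • ∫ w : traceZeroAdele F E c,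
            f (z⁻¹ * ((γ₀ : (quasiSplit F E c 3).Adelic) * (((heisElt hc 0 w : unipotentInBorel F E c 3) : borelAdelic F E c 3) : (quasiSplit F E c 3).Adelic)) * z) ∂(μA.map (traceZeroLine F E c hcδ hδ))) (g)) ∂νG =
        ((C : ℂ) * (((((μA.map (traceZeroLine F E c hcδ hδ)).real (traceZeroFundamentalDomain F E c) : ℝ) : ℂ)) * ((1 / 2 : ℂ) * (((idelicCovolume F νF).toReal : ℂ) * (((μA (adeleFundamentalDomain F)).toReal⁻¹ : ℂ) * adeleFourier F μA (fun s : AdeleRing (𝓞 F) F =>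
      ∫ x : AdeleRing (𝓞 E) E, (∫ k : ↥((standardMaximalCompactGL 3 E).comap (adelicVal F E c 3 ((StdForm.antidiagonal 3).over E)) : Subgroup (quasiSplit F E c 3).Adelic), f ((k : (quasiSplit F E c 3).Adelic)⁻¹ *
        (((((heisElt hc x (0 : traceZeroAdele F E c) : unipotentInBorel F E c 3) : borelAdelic F E c 3) : (quasiSplit F E c 3).Adelic))⁻¹ *
          ((γ₀ : (quasiSplit F E c 3).Adelic) * (((heisElt hc 0 (traceZeroLine F E c hcδ hδ s) : unipotentInBorel F E c 3) : borelAdelic F E c 3) : (quasiSplit F E c 3).Adelic)) *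
          (((heisElt hc x (0 : traceZeroAdele F E c) : unipotentInBorel F E c 3) : borelAdelic F E c 3) : (quasiSplit F E c 3).Adelic)) * (k : (quasiSplit F E c 3).Adelic)) ∂μK) ∂μX) 0))))) * ((Real.log (T : ℝ) : ℝ) : ℂ) +
          (C : ℂ) * (((((μA.map (traceZeroLine F E c hcδ hδ)).real (traceZeroFundamentalDomain F E c) : ℝ) : ℂ)) *
          ((1 / 2 : ℂ) * (-((((idelicCovolume F νF).toReal : ℂ) * ((Real.log ((borelHeight (1 : (quasiSplit F E c 3).Adelic) : ℝ≥0) : ℝ) : ℝ) : ℂ)) * (((μA (adeleFundamentalDomain F)).toReal⁻¹ : ℂ) * adeleFourier F μA (fun s : AdeleRing (𝓞 F) F =>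
      ∫ x : AdeleRing (𝓞 E) E, (∫ k : ↥((standardMaximalCompactGL 3 E).comap (adelicVal F E c 3 ((StdForm.antidiagonal 3).over E)) : Subgroup (quasiSplit F E c 3).Adelic), f ((k : (quasiSplit F E c 3).Adelic)⁻¹ *
        (((((heisElt hc x (0 : traceZeroAdele F E c) : unipotentInBorel F E c 3) : borelAdelic F E c 3) : (quasiSplit F E c 3).Adelic))⁻¹ *
          ((γ₀ : (quasiSplit F E c 3).Adelic) * (((heisElt hc 0 (traceZeroLine F E c hcδ hδ s) : unipotentInBorel F E c 3) : borelAdelic F E c 3) : (quasiSplit F E c 3).Adelic)) *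
          (((heisElt hc x (0 : traceZeroAdele F E c) : unipotentInBorel F E c 3) : borelAdelic F E c 3) : (quasiSplit F E c 3).Adelic)) * (k : (quasiSplit F E c 3).Adelic)) ∂μK) ∂μX) 0)) +
              ((∫ x in {x | 1 ≤ (IdeleClassGroup.ideleNorm F x : ℝ)} ∩ 𝓕F,
                  ideleSum F (fun s : AdeleRing (𝓞 F) F =>
      ∫ x : AdeleRing (𝓞 E) E, (∫ k : ↥((standardMaximalCompactGL 3 E).comap (adelicVal F E c 3 ((StdForm.antidiagonal 3).over E)) : Subgroup (quasiSplit F E c 3).Adelic), f ((k : (quasiSplit F E c 3).Adelic)⁻¹ *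
        (((((heisElt hc x (0 : traceZeroAdele F E c) : unipotentInBorel F E c 3) : borelAdelic F E c 3) : (quasiSplit F E c 3).Adelic))⁻¹ *
          ((γ₀ : (quasiSplit F E c 3).Adelic) * (((heisElt hc 0 (traceZeroLine F E c hcδ hδ s) : unipotentInBorel F E c 3) : borelAdelic F E c 3) : (quasiSplit F E c 3).Adelic)) *
          (((heisElt hc x (0 : traceZeroAdele F E c) : unipotentInBorel F E c 3) : borelAdelic F E c 3) : (quasiSplit F E c 3).Adelic)) * (k : (quasiSplit F E c 3).Adelic)) ∂μK) ∂μX) x * ((IdeleClassGroup.ideleNorm F x : ℝ) : ℂ) ∂νF) +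
                ((μA (adeleFundamentalDomain F)).toReal⁻¹ : ℂ) *
                  (∫ x in {x | 1 ≤ (IdeleClassGroup.ideleNorm F x : ℝ)} ∩ 𝓕F,
                    ideleSum F (adeleFourier F μA (fun s : AdeleRing (𝓞 F) F =>
      ∫ x : AdeleRing (𝓞 E) E, (∫ k : ↥((standardMaximalCompactGL 3 E).comap (adelicVal F E c 3 ((StdForm.antidiagonal 3).over E)) : Subgroup (quasiSplit F E c 3).Adelic), f ((k : (quasiSplit F E c 3).Adelic)⁻¹ *
        (((((heisElt hc x (0 : traceZeroAdele F E c) : unipotentInBorel F E c 3) : borelAdelic F E c 3) : (quasiSplit F E c 3).Adelic))⁻¹ *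
          ((γ₀ : (quasiSplit F E c 3).Adelic) * (((heisElt hc 0 (traceZeroLine F E c hcδ hδ s) : unipotentInBorel F E c 3) : borelAdelic F E c 3) : (quasiSplit F E c 3).Adelic)) *
          (((heisElt hc x (0 : traceZeroAdele F E c) : unipotentInBorel F E c 3) : borelAdelic F E c 3) : (quasiSplit F E c 3).Adelic)) * (k : (quasiSplit F E c 3).Adelic)) ∂μK) ∂μX)) x ∂νF) -
                ((idelicCovolume F νF).toReal : ℂ) * (fun s : AdeleRing (𝓞 F) F =>
      ∫ x : AdeleRing (𝓞 E) E, (∫ k : ↥((standardMaximalCompactGL 3 E).comap (adelicVal F E c 3 ((StdForm.antidiagonal 3).over E)) : Subgroup (quasiSplit F E c 3).Adelic), f ((k : (quasiSplit F E c 3).Adelic)⁻¹ *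
        (((((heisElt hc x (0 : traceZeroAdele F E c) : unipotentInBorel F E c 3) : borelAdelic F E c 3) : (quasiSplit F E c 3).Adelic))⁻¹ *
          ((γ₀ : (quasiSplit F E c 3).Adelic) * (((heisElt hc 0 (traceZeroLine F E c hcδ hδ s) : unipotentInBorel F E c 3) : borelAdelic F E c 3) : (quasiSplit F E c 3).Adelic)) *
          (((heisElt hc x (0 : traceZeroAdele F E c) : unipotentInBorel F E c 3) : borelAdelic F E c 3) : (quasiSplit F E c 3).Adelic)) * (k : (quasiSplit F E c 3).Adelic)) ∂μK) ∂μX) 0)) +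
            (1 / 2 : ℂ) * ((∫ x in {x | 1 ≤ (IdeleClassGroup.ideleNorm F x : ℝ)} ∩ 𝓕F,
                ideleSum F (fun s : AdeleRing (𝓞 F) F =>
      ∫ x : AdeleRing (𝓞 E) E, (∫ k : ↥((standardMaximalCompactGL 3 E).comap (adelicVal F E c 3 ((StdForm.antidiagonal 3).over E)) : Subgroup (quasiSplit F E c 3).Adelic), f ((k : (quasiSplit F E c 3).Adelic)⁻¹ *
        (((((heisElt hc x (0 : traceZeroAdele F E c) : unipotentInBorel F E c 3) : borelAdelic F E c 3) : (quasiSplit F E c 3).Adelic))⁻¹ *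
          ((γ₀ : (quasiSplit F E c 3).Adelic) * (((heisElt hc 0 (traceZeroLine F E c hcδ hδ s) : unipotentInBorel F E c 3) : borelAdelic F E c 3) : (quasiSplit F E c 3).Adelic)) *
          (((heisElt hc x (0 : traceZeroAdele F E c) : unipotentInBorel F E c 3) : borelAdelic F E c 3) : (quasiSplit F E c 3).Adelic)) * (k : (quasiSplit F E c 3).Adelic)) ∂μK) ∂μX) x * (-1 : ℂ) ^ (GaloisRepresentations.quadraticArtinIndicator F ((θ₀ : 𝓞 F) : F) x).val *
                  ((IdeleClassGroup.ideleNorm F x : ℝ) : ℂ) ∂νF) +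
              ((μA (adeleFundamentalDomain F)).toReal⁻¹ : ℂ) *
                ∫ x in {x | 1 ≤ (IdeleClassGroup.ideleNorm F x : ℝ)} ∩ 𝓕F,
                  ideleSum F (adeleFourier F μA (fun s : AdeleRing (𝓞 F) F =>
      ∫ x : AdeleRing (𝓞 E) E, (∫ k : ↥((standardMaximalCompactGL 3 E).comap (adelicVal F E c 3 ((StdForm.antidiagonal 3).over E)) : Subgroup (quasiSplit F E c 3).Adelic), f ((k : (quasiSplit F E c 3).Adelic)⁻¹ *
        (((((heisElt hc x (0 : traceZeroAdele F E c) : unipotentInBorel F E c 3) : borelAdelic F E c 3) : (quasiSplit F E c 3).Adelic))⁻¹ *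
          ((γ₀ : (quasiSplit F E c 3).Adelic) * (((heisElt hc 0 (traceZeroLine F E c hcδ hδ s) : unipotentInBorel F E c 3) : borelAdelic F E c 3) : (quasiSplit F E c 3).Adelic)) *
          (((heisElt hc x (0 : traceZeroAdele F E c) : unipotentInBorel F E c 3) : borelAdelic F E c 3) : (quasiSplit F E c 3).Adelic)) * (k : (quasiSplit F E c 3).Adelic)) ∂μK) ∂μX)) x *
                    (-1 : ℂ) ^ (GaloisRepresentations.quadraticArtinIndicator F ((θ₀ : 𝓞 F) : F) x⁻¹).val ∂νF))) := by
  obtain ⟨C, hC, h⟩ := exists_const_forall_integral_weight_smul_singularBracket_eq hc hc1 hcδ hδ θ₀ hθ hd hsq hBK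
    νG μB μT μK μX μA νF
  have hH₁ : (0 : ℝ) < ((borelHeight (1 : (quasiSplit F E c 3).Adelic) : ℝ≥0) : ℝ) := by
    haveI : T2Space (quasiSplit F E c 3).Adelic := inferInstanceAs (T2Space (adelic F E c 3 ((StdForm.antidiagonal 3).over E)))
    exact_mod_cast borelHeight_pos (1 : (quasiSplit F E c 3).Adelic)
  refine ⟨C, hC, ?_⟩
  intro a b hab g₀ γ₀ hg₀ hγ₀ f hf β hβ wT hwT 𝓕F h𝓕 T hT
  rw [h hab hg₀ hγ₀ hf hβ hwT h𝓕 T hT, Real.log_div hT.ne' hH₁.ne']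
  push_cast
  ring

end UnitaryGroup

end Literature.NumberTheory.Automorphic
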